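import Mathlib.Analysis.SpecialFunctions.Pow.Real
import Mathlib.Analysis.SpecialFunctions.Sqrt
import Mathlib.Algebra.BigOperators.Fin

/-!
# Type-I audit of the first-order commutator coefficients (level-independent, pure real algebra)

Helper file for the line `log-lipschitz-budget` of the crux
`ImplosionDichotomy.PolynomialCompression` (stmt-AtomisticToContinuum-12587), stub
`stub_logBudgetShadowing` (level-3 estimate, top-order part).
The one-step commutator of the frozen operator in the direction `l`,
`C_l(W) = (Σₘ ∂ₗuₘ ∂ₘW_ρ + ∂ₗρ div W_u ; Σₘ ∂ₗuₘ ∂ₘW_uⱼ + ∂ₗA ∂ⱼW_ρ + ∂ₗζ(ρ) ∂ⱼW_θ ;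
Σₘ ∂ₗuₘ ∂ₘW_θ + (2/3) ∂ₗ(θζ(ρ)) div W_u)`, has coefficients whose REFERENCE-DIRECTION parts
(`∂ₗu₁`, `∂ₗρ₁ = 3c₁²∂ₗc₁`, `A_θ ∂ₗθ₁ + A_ρ ∂ₗρ₁`, `ζ' ∂ₗρ₁ = (ζ1/ρ) ∂ₗρ₁`,
`(2/3)(ζ ∂ₗθ₁ + θ ζ' ∂ₗρ₁)`, with `A_θ = γ/ρ`, `A_ρ = θ(ργ' - γ)/ρ²`, `γ = ζ0 + ζ1`,
`ργ' = 2ζ1 + ζ2`) are Type I after weighting; paired with a top jet `X = (x_ρ, x_u, x_θ)`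
(weights `A, ρ, B`) against the gradient jets `Y = (Y_ρ m, Y_u m j, Y_θ m)` of another
top-order field this gives `≤ (Λ/λ)(½|X|²_w + ½ Σₘ |Yₘ|²_w)`. The δ-direction parts of the
coefficients are small and are estimated crudely elsewhere.
Proof: each monomial is absorbed by a weighted Young inequality `κ x y ≤ L · ½ (P x² + Q y²)`
(`κ² ≤ L² P Q`), the Type-I sizes of the coefficients being matched by the weights
(`A ρ ≈ K c₁²`, `ρ B ≈ c₁⁴/K`).  We take `Λ = 100 (K + 1) C`.
-/

namespace Summit.AtomisticToContinuum.HydrodynamicLimit.Theorems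

/-! ### Elementary absorption lemmas -/

/-- AM–GM absorption of a cross term `κ x y` into `L · ½ (P x² + Q y²)` when `κ² ≤ L² P Q`.
[folklore] -/
private lemma comm_cross_le {P Q L κ x y : ℝ} (hP : 0 < P) (hL : 0 ≤ L)
    (hκ : κ ^ 2 ≤ L ^ 2 * P * Q) : κ * x * y ≤ L * (1 / 2 * (P * x ^ 2 + Q * y ^ 2)) := by
  -- adapted from ImplosionDichotomyPolynomialCompressionPairingPointwise (cross_le)
  rcases hL.eq_or_lt with hL0 | hLpos
  · have hκ0 : κ = 0 := by
      rw [← hL0] at hκ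
      nlinarith [sq_nonneg κ]
    simp [hκ0, ← hL0]
  · have key : 0 ≤ (L * P * x - κ * y) ^ 2 + (L ^ 2 * P * Q - κ ^ 2) * y ^ 2 := by
      linarith [sq_nonneg (L * P * x - κ * y), mul_nonneg (sub_nonneg.2 hκ) (sq_nonneg y)]
    have hLP : 0 < L * P := mul_pos hLpos hP
    have hid : (L * P) * (2 * (L * (1 / 2 * (P * x ^ 2 + Q * y ^ 2)) - κ * x * y))
        = (L * P * x - κ * y) ^ 2 + (L ^ 2 * P * Q - κ ^ 2) * y ^ 2 := by ring
    have h3 : 0 ≤ 2 * (L * (1 / 2 * (P * x ^ 2 + Q * y ^ 2)) - κ * x * y) := by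
      refine (mul_nonneg_iff_of_pos_left hLP).1 ?_
      rw [hid]; exact key
    linarith

/-- Transport-type term: `P x (d y) ≤ ε · ½ (P x² + P y²)` for `|d| ≤ ε`, `P ≥ 0`. [folklore] -/
private lemma comm_diag_le {P ε x y d : ℝ} (hP : 0 ≤ P) (hd : |d| ≤ ε) :
    P * x * (d * y) ≤ ε * (1 / 2 * (P * x ^ 2 + P * y ^ 2)) := by
  obtain ⟨h1, h2⟩ := abs_le.1 hd
  have h : x * (d * y) ≤ ε * ((x ^ 2 + y ^ 2) / 2) := by
    nlinarith [mul_nonneg (sub_nonneg.2 h2) (sq_nonneg (x + y)),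
      mul_nonneg (show (0 : ℝ) ≤ ε + d by linarith) (sq_nonneg (x - y))]
  calc P * x * (d * y) = P * (x * (d * y)) := by ring
    _ ≤ P * (ε * ((x ^ 2 + y ^ 2) / 2)) := mul_le_mul_of_nonneg_left h hP
    _ = ε * (1 / 2 * (P * x ^ 2 + P * y ^ 2)) := by ring

/-- A transport group `P x Σₘ dₘ yₘ` (`|dₘ| ≤ ε`) is `≤ 4 ε E` once `P x² ≤ 2E`, `P Σ yₘ² ≤ 2E`.
[folklore] -/
private lemma comm_groupD_le {P ε E x : ℝ} {du y : Fin 3 → ℝ} (hP : 0 ≤ P) (hε : 0 ≤ ε)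
    (hdu : ∀ m, |du m| ≤ ε) (hEx : P * x ^ 2 ≤ 2 * E)
    (hEy : P * (y 0 ^ 2 + y 1 ^ 2 + y 2 ^ 2) ≤ 2 * E) :
    P * x * (du 0 * y 0 + du 1 * y 1 + du 2 * y 2) ≤ 4 * ε * E := by
  have h0 := comm_diag_le (x := x) (y := y 0) hP (hdu 0)
  have h1 := comm_diag_le (x := x) (y := y 1) hP (hdu 1)
  have h2 := comm_diag_le (x := x) (y := y 2) hP (hdu 2)
  have h3 := mul_le_mul_of_nonneg_left hEx hε
  have h4 := mul_le_mul_of_nonneg_left hEy hε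
  linarith

/-- The velocity transport group `P Σⱼ xⱼ Σₘ dₘ Yₘⱼ` (`|dₘ| ≤ ε`) is `≤ 4 ε E` once
`P Σ xⱼ² ≤ 2E` and `P Σ Yₘⱼ² ≤ 2E`. [folklore] -/
private lemma comm_groupU_le {P ε E : ℝ} {du x : Fin 3 → ℝ} {Y : Fin 3 → Fin 3 → ℝ}
    (hP : 0 ≤ P) (hε : 0 ≤ ε) (hdu : ∀ m, |du m| ≤ ε)
    (hEx : P * (x 0 ^ 2 + x 1 ^ 2 + x 2 ^ 2) ≤ 2 * E)
    (hEy : P * (Y 0 0 ^ 2 + Y 0 1 ^ 2 + Y 0 2 ^ 2 + (Y 1 0 ^ 2 + Y 1 1 ^ 2 + Y 1 2 ^ 2) +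
      (Y 2 0 ^ 2 + Y 2 1 ^ 2 + Y 2 2 ^ 2)) ≤ 2 * E) :
    P * (x 0 * (du 0 * Y 0 0 + du 1 * Y 1 0 + du 2 * Y 2 0) +
        x 1 * (du 0 * Y 0 1 + du 1 * Y 1 1 + du 2 * Y 2 1) +
        x 2 * (du 0 * Y 0 2 + du 1 * Y 1 2 + du 2 * Y 2 2)) ≤ 4 * ε * E := by
  have h00 := comm_diag_le (x := x 0) (y := Y 0 0) hP (hdu 0)
  have h10 := comm_diag_le (x := x 0) (y := Y 1 0) hP (hdu 1)
  have h20 := comm_diag_le (x := x 0) (y := Y 2 0) hP (hdu 2)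
  have h01 := comm_diag_le (x := x 1) (y := Y 0 1) hP (hdu 0)
  have h11 := comm_diag_le (x := x 1) (y := Y 1 1) hP (hdu 1)
  have h21 := comm_diag_le (x := x 1) (y := Y 2 1) hP (hdu 2)
  have h02 := comm_diag_le (x := x 2) (y := Y 0 2) hP (hdu 0)
  have h12 := comm_diag_le (x := x 2) (y := Y 1 2) hP (hdu 1)
  have h22 := comm_diag_le (x := x 2) (y := Y 2 2) hP (hdu 2)
  have h3 := mul_le_mul_of_nonneg_left hEx hε
  have h4 := mul_le_mul_of_nonneg_left hEy hε
  linarith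

/-- A cross group `κ x Σₘ yₘ` is `≤ 4 L E` once `κ² ≤ L² P Q`, `P x² ≤ 2E`, `Q Σ yₘ² ≤ 2E`.
[folklore] -/
private lemma comm_cross3_le {P Q L E κ x : ℝ} {y : Fin 3 → ℝ} (hP : 0 < P) (hL : 0 ≤ L)
    (hκ : κ ^ 2 ≤ L ^ 2 * P * Q) (hEx : P * x ^ 2 ≤ 2 * E)
    (hEy : Q * (y 0 ^ 2 + y 1 ^ 2 + y 2 ^ 2) ≤ 2 * E) :
    κ * x * (y 0 + y 1 + y 2) ≤ 4 * L * E := by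
  have h0 := comm_cross_le (x := x) (y := y 0) hP hL hκ
  have h1 := comm_cross_le (x := x) (y := y 1) hP hL hκ
  have h2 := comm_cross_le (x := x) (y := y 2) hP hL hκ
  have h3 := mul_le_mul_of_nonneg_left hEx hL
  have h4 := mul_le_mul_of_nonneg_left hEy hL
  linarith

/-- A diagonal cross group `Σⱼ κ xⱼ yⱼ` is `≤ 2 L E` once `κ² ≤ L² P Q`, `P Σ xⱼ² ≤ 2E`,
`Q Σ yⱼ² ≤ 2E`. [folklore] -/
private lemma comm_crossDiag3_le {P Q L E κ : ℝ} {x y : Fin 3 → ℝ} (hP : 0 < P) (hL : 0 ≤ L)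
    (hκ : κ ^ 2 ≤ L ^ 2 * P * Q) (hEx : P * (x 0 ^ 2 + x 1 ^ 2 + x 2 ^ 2) ≤ 2 * E)
    (hEy : Q * (y 0 ^ 2 + y 1 ^ 2 + y 2 ^ 2) ≤ 2 * E) :
    κ * x 0 * y 0 + κ * x 1 * y 1 + κ * x 2 * y 2 ≤ 2 * L * E := by
  have h0 := comm_cross_le (x := x 0) (y := y 0) hP hL hκ
  have h1 := comm_cross_le (x := x 1) (y := y 1) hP hL hκ
  have h2 := comm_cross_le (x := x 2) (y := y 2) hP hL hκ
  have h3 := mul_le_mul_of_nonneg_left hEx hL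
  have h4 := mul_le_mul_of_nonneg_left hEy hL
  linarith

/-! ### Type-I sizes of the reference coefficients -/

/-- Size of the `x_ρ · div Y_u` coefficient `3 c₁² A ∂c₁`: `(3c₁² A d)² ≤ (6(K+1)ε)² A ρ`.
[folklore] -/
private lemma comm_coeff_divu {K ε c₁ ρ A d : ℝ} (hK : 0 < K) (hc₁ : 0 < c₁)
    (hρ : 0 < ρ) (hApos : 0 < A) (hAc : A * c₁ ≤ 15 * K / 4) (h2ρ : c₁ ^ 3 ≤ 2 * ρ)
    (hd2 : d ^ 2 ≤ ε ^ 2) :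
    (A * (3 * c₁ ^ 2 * d)) ^ 2 ≤ (6 * (K + 1) * ε) ^ 2 * A * ρ := by
  calc (A * (3 * c₁ ^ 2 * d)) ^ 2 = 9 * A * (A * c₁) * c₁ ^ 3 * d ^ 2 := by ring
    _ ≤ 9 * A * (15 * K / 4) * (2 * ρ) * ε ^ 2 := by gcongr
    _ ≤ (6 * (K + 1) * ε) ^ 2 * A * ρ := by
        have : 0 ≤ ε ^ 2 * A * ρ * (36 * K ^ 2 + 9 / 2 * K + 36) := by positivity
        linarith

/-- Size of the `x_u · Y_ρ` coefficient `ρ ∂ₗA = γ ∂ₗθ₁ + (θ/ρ)(ργ' - γ) ∂ₗρ₁`: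
`κ² ≤ (25(K+1)ε)² ρ A`. [folklore] -/
private lemma comm_coeff_dA {K ε c₁ ρ A T γ μ d κ : ℝ} (hK : 0 < K)
    (hc₁ : 0 < c₁) (hρ : 0 < ρ) (hApos : 0 < A) (hT : 0 < T) (hTc : T * c₁ ≤ 3 * K)
    (h83 : K * c₁ ^ 2 ≤ 8 / 3 * (A * ρ)) (hγ2 : γ ^ 2 ≤ (5 / 4) ^ 2)
    (hμ2 : μ ^ 2 ≤ (13 / 8) ^ 2) (hd2 : d ^ 2 ≤ ε ^ 2)
    (hκ : κ = γ * (2 * K * c₁ * d) + T * μ * (3 * c₁ ^ 2 * d)) :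
    κ ^ 2 ≤ (25 * (K + 1) * ε) ^ 2 * ρ * A := by
  have hTc2 : (T * c₁) ^ 2 ≤ (3 * K) ^ 2 := pow_le_pow_left₀ (by positivity) hTc 2
  calc κ ^ 2 = (γ * (2 * K * c₁ * d) + T * μ * (3 * c₁ ^ 2 * d)) ^ 2 := by rw [hκ]
    _ ≤ 2 * (γ * (2 * K * c₁ * d)) ^ 2 + 2 * (T * μ * (3 * c₁ ^ 2 * d)) ^ 2 := by
        nlinarith [sq_nonneg (γ * (2 * K * c₁ * d) - T * μ * (3 * c₁ ^ 2 * d))]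
    _ = 8 * K ^ 2 * c₁ ^ 2 * γ ^ 2 * d ^ 2 + 18 * c₁ ^ 2 * (T * c₁) ^ 2 * μ ^ 2 * d ^ 2 := by
        ring
    _ ≤ 8 * K ^ 2 * c₁ ^ 2 * (5 / 4) ^ 2 * ε ^ 2 +
          18 * c₁ ^ 2 * (3 * K) ^ 2 * (13 / 8) ^ 2 * ε ^ 2 := by gcongr
    _ = 14089 / 32 * K * (K * c₁ ^ 2) * ε ^ 2 := by ring
    _ ≤ 14089 / 32 * K * (8 / 3 * (A * ρ)) * ε ^ 2 := by gcongr
    _ ≤ (25 * (K + 1) * ε) ^ 2 * ρ * A := by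
        have : 0 ≤ ε ^ 2 * A * ρ * (625 * K ^ 2 + 911 / 12 * K + 625) := by positivity
        linarith

/-- Size of the `x_u · Y_θ` coefficient `ρ ζ' ∂ₗρ₁ = ζ1 · 3c₁² ∂c₁`: `κ² ≤ ((K+1)ε)² ρ B`.
[folklore] -/
private lemma comm_coeff_dZ {K ε c₁ ρ B ζ1 d κ : ℝ} (hK : 0 < K) (hc₁ : 0 < c₁)
    (hρ : 0 < ρ) (hBpos : 0 < B) (h2ρ : c₁ ^ 3 ≤ 2 * ρ) (hBK1 : ρ ≤ B * (K * c₁ ^ 2))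
    (hζ1 : ζ1 ^ 2 ≤ (1 / 8) ^ 2) (hd2 : d ^ 2 ≤ ε ^ 2) (hκ : κ = ζ1 * (3 * c₁ ^ 2 * d)) :
    κ ^ 2 ≤ ((K + 1) * ε) ^ 2 * ρ * B := by
  have hKc : 0 < K * c₁ ^ 2 := by positivity
  have h6 : c₁ ^ 3 * c₁ ^ 3 ≤ (2 * ρ) * (2 * ρ) :=
    mul_le_mul h2ρ h2ρ (by positivity) (by positivity)
  refine le_of_mul_le_mul_right ?_ hKc
  calc κ ^ 2 * (K * c₁ ^ 2) = 9 * K * ζ1 ^ 2 * d ^ 2 * (c₁ ^ 3 * c₁ ^ 3) := by rw [hκ]; ring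
    _ ≤ 9 * K * (1 / 8) ^ 2 * ε ^ 2 * ((2 * ρ) * (2 * ρ)) := by gcongr
    _ = 9 / 16 * K * ε ^ 2 * ρ * ρ := by ring
    _ ≤ 9 / 16 * K * ε ^ 2 * ρ * (B * (K * c₁ ^ 2)) := by gcongr
    _ ≤ ((K + 1) * ε) ^ 2 * ρ * B * (K * c₁ ^ 2) := by
        have : 0 ≤ ε ^ 2 * ρ * B * (K * c₁ ^ 2) * (K ^ 2 + 23 / 16 * K + 1) := by positivity
        linarith

/-- Size of the `x_θ · div Y_u` coefficient `(2/3) B (ζ ∂ₗθ₁ + θ ζ' ∂ₗρ₁)`: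
`(B c_t)² ≤ (3(K+1)ε)² B ρ`. [folklore] -/
private lemma comm_coeff_dT {K ε c₁ ρ B T ζ0 ζ1 d ct : ℝ} (hK : 0 < K)
    (hc₁ : 0 < c₁) (hρ : 0 < ρ) (hBpos : 0 < B) (hT : 0 < T) (hTc : T * c₁ ≤ 3 * K)
    (hBK2 : B * (K * c₁ ^ 2) ≤ 3 * ρ) (hζ0 : ζ0 ^ 2 ≤ (9 / 8) ^ 2) (hζ1 : ζ1 ^ 2 ≤ (1 / 8) ^ 2)
    (hd2 : d ^ 2 ≤ ε ^ 2)
    (hct : ct = 2 / 3 * (ζ0 * (2 * K * c₁ * d) + T * ζ1 * (3 * c₁ ^ 2 * d))) :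
    (B * ct) ^ 2 ≤ (3 * (K + 1) * ε) ^ 2 * B * ρ := by
  have hTc2 : (T * c₁) ^ 2 ≤ (3 * K) ^ 2 := pow_le_pow_left₀ (by positivity) hTc 2
  have hct2 : ct ^ 2 ≤ 45 / 8 * K * (K * c₁ ^ 2) * ε ^ 2 := by
    calc ct ^ 2 = 4 / 9 * (ζ0 * (2 * K * c₁ * d) + T * ζ1 * (3 * c₁ ^ 2 * d)) ^ 2 := by
          rw [hct]; ring
      _ ≤ 4 / 9 * (2 * (ζ0 * (2 * K * c₁ * d)) ^ 2 + 2 * (T * ζ1 * (3 * c₁ ^ 2 * d)) ^ 2) :=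
          mul_le_mul_of_nonneg_left
            (by nlinarith [sq_nonneg (ζ0 * (2 * K * c₁ * d) - T * ζ1 * (3 * c₁ ^ 2 * d))])
            (by norm_num)
      _ = 32 / 9 * K ^ 2 * c₁ ^ 2 * ζ0 ^ 2 * d ^ 2 +
            8 * c₁ ^ 2 * (T * c₁) ^ 2 * ζ1 ^ 2 * d ^ 2 := by ring
      _ ≤ 32 / 9 * K ^ 2 * c₁ ^ 2 * (9 / 8) ^ 2 * ε ^ 2 +
            8 * c₁ ^ 2 * (3 * K) ^ 2 * (1 / 8) ^ 2 * ε ^ 2 := by gcongr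
      _ = 45 / 8 * K * (K * c₁ ^ 2) * ε ^ 2 := by ring
  calc (B * ct) ^ 2 = B * ct ^ 2 * B := by ring
    _ ≤ B * (45 / 8 * K * (K * c₁ ^ 2) * ε ^ 2) * B := by gcongr
    _ = 45 / 8 * K * ε ^ 2 * B * (B * (K * c₁ ^ 2)) := by ring
    _ ≤ 45 / 8 * K * ε ^ 2 * B * (3 * ρ) := by gcongr
    _ ≤ (3 * (K + 1) * ε) ^ 2 * B * ρ := by
        have : 0 ≤ ε ^ 2 * B * ρ * (9 * K ^ 2 + 9 / 8 * K + 9) := by positivity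
        linarith

/-! ### The bootstrap window and the energy pieces -/

/-- The bootstrap window: positivity and the comparison of the weights `A = θγ/ρ`, `B = 3ρ/(2θ)`
and the ratio `T = θ/ρ` with the reference scales. [folklore] -/
private lemma comm_regime {K c₁ ρ θ ζ0 ζ1 A B T : ℝ} (hK : 0 < K) (hc₁ : 0 < c₁)
    (hζ0 : |ζ0 - 1| ≤ 1 / 8) (hζ1 : |ζ1| ≤ 1 / 8)
    (hρ : |ρ - c₁ ^ 3| ≤ c₁ ^ 3 / 2) (hθ : |θ - K * c₁ ^ 2| ≤ K * c₁ ^ 2 / 2)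
    (hA : A = θ * (ζ0 + ζ1) / ρ) (hB : B = 3 / 2 * ρ / θ) (hT : T = θ / ρ) :
    0 < ρ ∧ 0 < A ∧ 0 < B ∧ 0 < T ∧ c₁ ^ 3 ≤ 2 * ρ ∧ T * c₁ ≤ 3 * K ∧
      K * c₁ ^ 2 ≤ 8 / 3 * (A * ρ) ∧ A * c₁ ≤ 15 * K / 4 ∧
      ρ ≤ B * (K * c₁ ^ 2) ∧ B * (K * c₁ ^ 2) ≤ 3 * ρ := by
  obtain ⟨⟨hr1, hr2⟩, ht1, ht2⟩ := And.intro (abs_le.1 hρ) (abs_le.1 hθ)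
  obtain ⟨⟨hz1, hz2⟩, hy1, hy2⟩ := And.intro (abs_le.1 hζ0) (abs_le.1 hζ1)
  obtain ⟨hc2, hc3⟩ : 0 < c₁ ^ 2 ∧ 0 < c₁ ^ 3 := ⟨by positivity, by positivity⟩
  have hKc : 0 < K * c₁ ^ 2 := by positivity
  have hρlo : c₁ ^ 3 / 2 ≤ ρ := by linarith
  have hθlo : K * c₁ ^ 2 / 2 ≤ θ := by linarith
  have hθhi : θ ≤ 3 * (K * c₁ ^ 2) / 2 := by linarith
  have hρpos : 0 < ρ := by linarith
  have hθpos : 0 < θ := by linarith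
  obtain ⟨hγlo, hγhi⟩ : 3 / 4 ≤ ζ0 + ζ1 ∧ ζ0 + ζ1 ≤ 5 / 4 := ⟨by linarith, by linarith⟩
  have hγpos : 0 < ζ0 + ζ1 := by linarith
  have hApos : 0 < A := by rw [hA]; positivity
  have hBpos : 0 < B := by rw [hB]; positivity
  have hTpos : 0 < T := by rw [hT]; positivity
  have hAρ : A * ρ = θ * (ζ0 + ζ1) := by rw [hA]; field_simp
  have hBθ : B * θ = 3 / 2 * ρ := by rw [hB]; field_simp
  have hTρ : T * ρ = θ := by rw [hT]; field_simp
  have hTc : T * c₁ ≤ 3 * K := by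
    refine le_of_mul_le_mul_right ?_ hρpos
    calc T * c₁ * ρ = θ * c₁ := by rw [← hTρ]; ring
      _ ≤ 3 * (K * c₁ ^ 2) / 2 * c₁ := by gcongr
      _ = 3 * K * (c₁ ^ 3 / 2) := by ring
      _ ≤ 3 * K * ρ := by gcongr
  have hAρlo : 3 * (K * c₁ ^ 2) / 8 ≤ A * ρ := by
    rw [hAρ]; linarith [mul_le_mul hθlo hγlo (by norm_num) hθpos.le]
  have hAc : A * c₁ ≤ 15 * K / 4 := by
    have h0 := mul_le_mul hθhi hγhi hγpos.le (by positivity)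
    have h1 : A * (c₁ ^ 3 / 2) ≤ A * ρ := mul_le_mul_of_nonneg_left hρlo hApos.le
    have h2 : A * c₁ * c₁ ^ 2 ≤ 15 * K / 4 * c₁ ^ 2 := by rw [hAρ] at h1; linarith
    exact le_of_mul_le_mul_right h2 hc2
  have hBK1 : ρ ≤ B * (K * c₁ ^ 2) := by linarith [mul_le_mul_of_nonneg_left hθhi hBpos.le]
  have hBK2 : B * (K * c₁ ^ 2) ≤ 3 * ρ := by linarith [mul_le_mul_of_nonneg_left hθlo hBpos.le]
  exact ⟨hρpos, hApos, hBpos, hTpos, by linarith, hTc, by linarith, hAc, hBK1, hBK2⟩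

/-- The pieces of the energy `E = ½|X|²_w + ½ Σₘ |Yₘ|²_w` are bounded by `2E`. [folklore] -/
private lemma comm_energy_pieces {A ρ B E xρ xθ : ℝ} {xu Yρ Yθ : Fin 3 → ℝ}
    {Yu : Fin 3 → Fin 3 → ℝ} (hA : 0 < A) (hρ : 0 < ρ) (hB : 0 < B)
    (hE : E = 1 / 2 * (A * xρ ^ 2 + ρ * (xu 0 ^ 2 + xu 1 ^ 2 + xu 2 ^ 2) + B * xθ ^ 2) +
      1 / 2 * (A * Yρ 0 ^ 2 + ρ * (Yu 0 0 ^ 2 + Yu 0 1 ^ 2 + Yu 0 2 ^ 2) + B * Yθ 0 ^ 2 +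
        (A * Yρ 1 ^ 2 + ρ * (Yu 1 0 ^ 2 + Yu 1 1 ^ 2 + Yu 1 2 ^ 2) + B * Yθ 1 ^ 2) +
        (A * Yρ 2 ^ 2 + ρ * (Yu 2 0 ^ 2 + Yu 2 1 ^ 2 + Yu 2 2 ^ 2) + B * Yθ 2 ^ 2))) :
    0 ≤ E ∧ A * xρ ^ 2 ≤ 2 * E ∧ ρ * (xu 0 ^ 2 + xu 1 ^ 2 + xu 2 ^ 2) ≤ 2 * E ∧
      B * xθ ^ 2 ≤ 2 * E ∧ A * (Yρ 0 ^ 2 + Yρ 1 ^ 2 + Yρ 2 ^ 2) ≤ 2 * E ∧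
      ρ * (Yu 0 0 ^ 2 + Yu 0 1 ^ 2 + Yu 0 2 ^ 2 + (Yu 1 0 ^ 2 + Yu 1 1 ^ 2 + Yu 1 2 ^ 2) +
        (Yu 2 0 ^ 2 + Yu 2 1 ^ 2 + Yu 2 2 ^ 2)) ≤ 2 * E ∧
      ρ * (Yu 0 0 ^ 2 + Yu 1 1 ^ 2 + Yu 2 2 ^ 2) ≤ 2 * E ∧
      B * (Yθ 0 ^ 2 + Yθ 1 ^ 2 + Yθ 2 ^ 2) ≤ 2 * E := by
  have n1 : 0 ≤ A * xρ ^ 2 := by positivity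
  have n2 : 0 ≤ ρ * (xu 0 ^ 2 + xu 1 ^ 2 + xu 2 ^ 2) := by positivity
  have n3 : 0 ≤ B * xθ ^ 2 := by positivity
  have n4 : 0 ≤ A * (Yρ 0 ^ 2 + Yρ 1 ^ 2 + Yρ 2 ^ 2) := by positivity
  have n5 : 0 ≤ ρ * (Yu 0 0 ^ 2 + Yu 1 1 ^ 2 + Yu 2 2 ^ 2) := by positivity
  have n6 : 0 ≤ ρ * (Yu 0 1 ^ 2 + Yu 0 2 ^ 2 + Yu 1 0 ^ 2 + Yu 1 2 ^ 2 + Yu 2 0 ^ 2 +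
      Yu 2 1 ^ 2) := by positivity
  have n7 : 0 ≤ B * (Yθ 0 ^ 2 + Yθ 1 ^ 2 + Yθ 2 ^ 2) := by positivity
  have h2E : 2 * E = A * xρ ^ 2 + ρ * (xu 0 ^ 2 + xu 1 ^ 2 + xu 2 ^ 2) + B * xθ ^ 2 +
      A * (Yρ 0 ^ 2 + Yρ 1 ^ 2 + Yρ 2 ^ 2) + ρ * (Yu 0 0 ^ 2 + Yu 1 1 ^ 2 + Yu 2 2 ^ 2) +
      ρ * (Yu 0 1 ^ 2 + Yu 0 2 ^ 2 + Yu 1 0 ^ 2 + Yu 1 2 ^ 2 + Yu 2 0 ^ 2 + Yu 2 1 ^ 2) +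
      B * (Yθ 0 ^ 2 + Yθ 1 ^ 2 + Yθ 2 ^ 2) := by
    rw [hE]; ring
  refine ⟨?_, ?_, ?_, ?_, ?_, ?_, ?_, ?_⟩ <;> linarith only [h2E, n1, n2, n3, n4, n5, n6, n7]

/-! ### The bound with the algebra done -/

/-- The commutator pairing estimate in terms of the weights `A = θ(ζ0+ζ1)/ρ`, `B = 3ρ/(2θ)`, the
coefficients `c_a, c_z, c_t`, the total energy `E` and the derivative scale `ε = C/λ`.
[folklore] -/
private theorem comm_main_bound (K ε c₁ ρ θ ζ0 ζ1 ζ2 d xρ xθ A B E ca cz ct : ℝ)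
    (du xu Yρ Yθ : Fin 3 → ℝ) (Yu : Fin 3 → Fin 3 → ℝ)
    (hK : 0 < K) (hε : 0 ≤ ε) (hc₁ : 0 < c₁)
    (hζ0 : |ζ0 - 1| ≤ 1 / 8) (hζ1 : |ζ1| ≤ 1 / 8) (hζ2 : |ζ2| ≤ 1 / 8)
    (hρ : |ρ - c₁ ^ 3| ≤ c₁ ^ 3 / 2) (hθ : |θ - K * c₁ ^ 2| ≤ K * c₁ ^ 2 / 2)
    (hdu : ∀ m, |du m| ≤ ε) (hd : |d| ≤ ε)
    (hA : A = θ * (ζ0 + ζ1) / ρ) (hB : B = 3 / 2 * ρ / θ)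
    (hca : ca = (ζ0 + ζ1) / ρ * (2 * K * c₁ * d) +
      θ * (2 * ζ1 + ζ2 - (ζ0 + ζ1)) / ρ ^ 2 * (3 * c₁ ^ 2 * d))
    (hcz : cz = ζ1 / ρ * (3 * c₁ ^ 2 * d))
    (hct : ct = 2 / 3 * (ζ0 * (2 * K * c₁ * d) + θ * (ζ1 / ρ) * (3 * c₁ ^ 2 * d)))
    (hE : E = 1 / 2 * (A * xρ ^ 2 + ρ * (xu 0 ^ 2 + xu 1 ^ 2 + xu 2 ^ 2) + B * xθ ^ 2) +
      1 / 2 * (A * Yρ 0 ^ 2 + ρ * (Yu 0 0 ^ 2 + Yu 0 1 ^ 2 + Yu 0 2 ^ 2) + B * Yθ 0 ^ 2 +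
        (A * Yρ 1 ^ 2 + ρ * (Yu 1 0 ^ 2 + Yu 1 1 ^ 2 + Yu 1 2 ^ 2) + B * Yθ 1 ^ 2) +
        (A * Yρ 2 ^ 2 + ρ * (Yu 2 0 ^ 2 + Yu 2 1 ^ 2 + Yu 2 2 ^ 2) + B * Yθ 2 ^ 2))) :
    A * xρ * (du 0 * Yρ 0 + du 1 * Yρ 1 + du 2 * Yρ 2 +
        3 * c₁ ^ 2 * d * (Yu 0 0 + Yu 1 1 + Yu 2 2)) +
      ρ * (xu 0 * (du 0 * Yu 0 0 + du 1 * Yu 1 0 + du 2 * Yu 2 0 + ca * Yρ 0 + cz * Yθ 0) +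
          xu 1 * (du 0 * Yu 0 1 + du 1 * Yu 1 1 + du 2 * Yu 2 1 + ca * Yρ 1 + cz * Yθ 1) +
          xu 2 * (du 0 * Yu 0 2 + du 1 * Yu 1 2 + du 2 * Yu 2 2 + ca * Yρ 2 + cz * Yθ 2)) +
      B * xθ * (du 0 * Yθ 0 + du 1 * Yθ 1 + du 2 * Yθ 2 + ct * (Yu 0 0 + Yu 1 1 + Yu 2 2))
      ≤ 100 * (K + 1) * ε * E := by
  -- the ratio `T = θ / ρ` and the bootstrap window
  obtain ⟨T, hT⟩ : ∃ T : ℝ, T = θ / ρ := ⟨_, rfl⟩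
  obtain ⟨hρpos, hApos, hBpos, hTpos, h2ρ, hTc, h83, hAc, hBK1, hBK2⟩ :=
    comm_regime hK hc₁ hζ0 hζ1 hρ hθ hA hB hT
  obtain ⟨⟨hz1, hz2⟩, hy1, hy2⟩ := And.intro (abs_le.1 hζ0) (abs_le.1 hζ1)
  obtain ⟨⟨hw1, hw2⟩, hd1', hd2'⟩ := And.intro (abs_le.1 hζ2) (abs_le.1 hd)
  -- squares of the small quantities
  have hd2 : d ^ 2 ≤ ε ^ 2 := sq_le_sq' hd1' hd2'
  have hγ2 : (ζ0 + ζ1) ^ 2 ≤ (5 / 4) ^ 2 := sq_le_sq' (by linarith) (by linarith)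
  have hμ2 : (2 * ζ1 + ζ2 - (ζ0 + ζ1)) ^ 2 ≤ (13 / 8) ^ 2 := sq_le_sq' (by linarith) (by linarith)
  have hζ0sq : ζ0 ^ 2 ≤ (9 / 8) ^ 2 := sq_le_sq' (by linarith) (by linarith)
  have hζ1sq : ζ1 ^ 2 ≤ (1 / 8) ^ 2 := sq_le_sq' (by linarith) hy2
  -- the coefficients, cleared of denominators
  have hι : ρ * ρ⁻¹ = 1 := mul_inv_cancel₀ hρpos.ne'
  have hca' : ρ * ca = (ζ0 + ζ1) * (2 * K * c₁ * d) +
      T * (2 * ζ1 + ζ2 - (ζ0 + ζ1)) * (3 * c₁ ^ 2 * d) := by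
    rw [hca, hT]
    linear_combination
      ((ζ0 + ζ1) * (2 * K * c₁ * d) +
        θ * ρ⁻¹ * (2 * ζ1 + ζ2 - (ζ0 + ζ1)) * (3 * c₁ ^ 2 * d)) * hι
  have hcz' : ρ * cz = ζ1 * (3 * c₁ ^ 2 * d) := by
    rw [hcz]; linear_combination (ζ1 * (3 * c₁ ^ 2 * d)) * hι
  have hct' : ct = 2 / 3 * (ζ0 * (2 * K * c₁ * d) + T * ζ1 * (3 * c₁ ^ 2 * d)) := by
    rw [hct, hT]; ring
  have hκ2 := comm_coeff_divu hK hc₁ hρpos hApos hAc h2ρ hd2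
  have hκ4 := comm_coeff_dA hK hc₁ hρpos hApos hTpos hTc h83 hγ2 hμ2 hd2 hca'
  have hκ5 := comm_coeff_dZ hK hc₁ hρpos hBpos h2ρ hBK1 hζ1sq hd2 hcz'
  have hκ7 := comm_coeff_dT hK hc₁ hρpos hBpos hTpos hTc hBK2 hζ0sq hζ1sq hd2 hct'
  -- the pieces of the energy
  obtain ⟨hE0, F1, Fxu, F3, F4, FYu, F6, F7⟩ := comm_energy_pieces hApos hρpos hBpos hE
  -- the seven groups of monomials
  have G1 : A * xρ * (du 0 * Yρ 0 + du 1 * Yρ 1 + du 2 * Yρ 2) ≤ 4 * ε * E :=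
    comm_groupD_le (x := xρ) (du := du) (y := Yρ) hApos.le hε hdu F1 F4
  have G2 : A * (3 * c₁ ^ 2 * d) * xρ * (Yu 0 0 + Yu 1 1 + Yu 2 2) ≤
      4 * (6 * (K + 1) * ε) * E :=
    comm_cross3_le (x := xρ) (y := fun m => Yu m m) hApos (by positivity) hκ2 F1 F6
  have G3 : ρ * (xu 0 * (du 0 * Yu 0 0 + du 1 * Yu 1 0 + du 2 * Yu 2 0) +
      xu 1 * (du 0 * Yu 0 1 + du 1 * Yu 1 1 + du 2 * Yu 2 1) +
      xu 2 * (du 0 * Yu 0 2 + du 1 * Yu 1 2 + du 2 * Yu 2 2)) ≤ 4 * ε * E :=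
    comm_groupU_le (x := xu) (du := du) (Y := Yu) hρpos.le hε hdu Fxu FYu
  have G4 : ρ * ca * xu 0 * Yρ 0 + ρ * ca * xu 1 * Yρ 1 + ρ * ca * xu 2 * Yρ 2 ≤
      2 * (25 * (K + 1) * ε) * E :=
    comm_crossDiag3_le (x := xu) (y := Yρ) hρpos (by positivity) hκ4 Fxu F4
  have G5 : ρ * cz * xu 0 * Yθ 0 + ρ * cz * xu 1 * Yθ 1 + ρ * cz * xu 2 * Yθ 2 ≤
      2 * ((K + 1) * ε) * E :=
    comm_crossDiag3_le (x := xu) (y := Yθ) hρpos (by positivity) hκ5 Fxu F7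
  have G6 : B * xθ * (du 0 * Yθ 0 + du 1 * Yθ 1 + du 2 * Yθ 2) ≤ 4 * ε * E :=
    comm_groupD_le (x := xθ) (du := du) (y := Yθ) hBpos.le hε hdu F3 F7
  have G7 : B * ct * xθ * (Yu 0 0 + Yu 1 1 + Yu 2 2) ≤ 4 * (3 * (K + 1) * ε) * E :=
    comm_cross3_le (x := xθ) (y := fun m => Yu m m) hBpos (by positivity) hκ7 F3 F6
  have hslack : 0 ≤ K * ε * E := by positivity
  linear_combination G1 + G2 + G3 + G4 + G5 + G6 + G7 + 12 * hslack

/-- **Type-I bound of the reference-coefficient commutator pairing, generic jets.** Given `K > 0`,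
`C, cZ ≥ 0` there is `Λ ≥ 0` such that at every point of the bootstrap regime and for arbitrary numbers
`x_ρ, x_θ, x_u j` and `Y_ρ m, Y_θ m, Y_u m j` and every direction `l`, with `A = θ(ζ0+ζ1)/ρ`,
`B = 3ρ/(2θ)` and the coefficients of the module docstring (`du₁ l m = ∂ₗu₁ₘ`, `dc₁ l = ∂ₗc₁`):
the pairing is `≤ (Λ/λ)(½(A x_ρ² + ρ Σⱼ x_uⱼ² + B x_θ²) + ½ Σₘ (A Y_ρₘ² + ρ Σⱼ Y_uₘⱼ² + B Y_θₘ²))`.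
[folklore] -/
theorem shadow_commAudit_pointwise :
    ∀ (K C cZ : ℝ), 0 < K → 0 ≤ C → 0 ≤ cZ →
      ∃ Λ : ℝ, 0 ≤ Λ ∧
        ∀ (lam c₁ ρ θ ζ0 ζ1 ζ2 ηh : ℝ) (du₁ : Fin 3 → Fin 3 → ℝ) (dc₁ : Fin 3 → ℝ)
          (xρ xθ : ℝ) (xu : Fin 3 → ℝ) (Yρ Yθ : Fin 3 → ℝ) (Yu : Fin 3 → Fin 3 → ℝ) (l : Fin 3),
          0 < lam → 0 < c₁ → 0 ≤ ηh → ηh * (cZ + 1) ≤ 1 / 8 →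
          |ζ0 - 1| ≤ cZ * ηh → |ζ1| ≤ cZ * ηh → |ζ2| ≤ cZ * ηh →
          |ρ - c₁ ^ 3| ≤ c₁ ^ 3 / 2 → |θ - K * c₁ ^ 2| ≤ K * c₁ ^ 2 / 2 →
          (∀ i j, |du₁ i j| ≤ C / lam) → (∀ i, |dc₁ i| ≤ C / lam) →
          θ * (ζ0 + ζ1) / ρ * xρ *
              (∑ m, du₁ l m * Yρ m + 3 * c₁ ^ 2 * dc₁ l * ∑ m, Yu m m) +
            ρ * ∑ j, xu j *
              (∑ m, du₁ l m * Yu m j +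
                ((ζ0 + ζ1) / ρ * (2 * K * c₁ * dc₁ l) +
                    θ * (2 * ζ1 + ζ2 - (ζ0 + ζ1)) / ρ ^ 2 * (3 * c₁ ^ 2 * dc₁ l)) * Yρ j +
                ζ1 / ρ * (3 * c₁ ^ 2 * dc₁ l) * Yθ j) +
            3 / 2 * ρ / θ * xθ *
              (∑ m, du₁ l m * Yθ m +
                2 / 3 * (ζ0 * (2 * K * c₁ * dc₁ l) + θ * (ζ1 / ρ) * (3 * c₁ ^ 2 * dc₁ l)) *
                  ∑ m, Yu m m)
            ≤ Λ / lam *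
              (1 / 2 * (θ * (ζ0 + ζ1) / ρ * xρ ^ 2 + ρ * ∑ j, xu j ^ 2 + 3 / 2 * ρ / θ * xθ ^ 2) +
                1 / 2 * ∑ m, (θ * (ζ0 + ζ1) / ρ * Yρ m ^ 2 + ρ * ∑ j, Yu m j ^ 2 +
                  3 / 2 * ρ / θ * Yθ m ^ 2)) := by
  intro K C cZ hK hC hcZ
  refine ⟨100 * (K + 1) * C, by positivity, ?_⟩
  intro lam c₁ ρ θ ζ0 ζ1 ζ2 ηh du₁ dc₁ xρ xθ xu Yρ Yθ Yu l hlam hc₁ hηh hηcZ hζ0 hζ1 hζ2 hρ hθ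
    hdu₁ hdc₁
  have hsmall : cZ * ηh ≤ 1 / 8 := by linarith
  have key := comm_main_bound K (C / lam) c₁ ρ θ ζ0 ζ1 ζ2 (dc₁ l) xρ xθ _ _ _ _ _ _ (du₁ l) xu
    Yρ Yθ Yu hK (by positivity) hc₁ (hζ0.trans hsmall) (hζ1.trans hsmall) (hζ2.trans hsmall)
    hρ hθ (fun m => hdu₁ l m) (hdc₁ l) rfl rfl rfl rfl rfl rfl
  simp only [Fin.sum_univ_three]
  exact le_trans (le_of_eq (by ring)) (key.trans_eq (by ring))

end Summit.AtomisticToContinuum.HydrodynamicLimit.Theorems
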